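import Literature.NumberTheory.DiophantineGeometry.FunctionFieldRayClassLSeries
import Literature.NumberTheory.DiophantineGeometry.FunctionFieldZetaEulerProductProofs
import Literature.NumberTheory.DiophantineGeometry.FunctionFieldHasseWeilReductionProofs
import Mathlib.RingTheory.PowerSeries.Derivative
import HarnessLib

/-!
# The Euler product of a ray class `L`-series and the passage to its inverse roots (Rosen Ch. 9;
Stichtenoth Prop. 5.1.8, Cor. 5.1.17 (a), Lemma 5.2.5)

Continuation of `FunctionFieldRayClassLSeries` (the `L`-series
`L(χ, t) = Σ_{D ≥ 0, P ∉ supp D} χ(D) t^{deg D}` of a function on divisors away from a place `P`,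
and its polynomiality for nontrivial ray class functions). For a **character `χ` of the divisor
group** (so that `χ` is multiplicative on divisors) this file proves:

* `placePowerSum P χ r = S_r(χ) = Σ_{v ≠ P, deg v ∣ r} deg v · χ(v)^{r/deg v}` (the coefficients of
  `t (log L(χ,t))'`), `placePowerSum_eq_sum`;
* **the Euler product in coefficient form** `natCast_mul_rayClassCoeff_eq_sum`:
  `n a_n(χ) = Σ_{r=1}^{n} S_r(χ) a_{n-r}(χ)`, i.e. `X_mul_derivative_rayClassLSeries`:
  `t L'(χ, t) = L(χ, t) · Σ_{r ≥ 1} S_r(χ) t^r` in `ℂ⟦t⟧` — the logarithmic derivative of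
  `L(χ, t) = ∏_{v ≠ P} (1 - χ(v) t^{deg v})⁻¹`, proved by double counting exactly as the tree's
  `FunctionFieldZetaEulerProductProofs` does for the zeta function (layer-cake formula and the shift
  `A ↦ A - m·v`, now weighted by `χ(A) = χ(v)^m χ(A - m·v)`);
* **from `t L'/L` to the inverse roots** (pure algebra over `ℂ`, for any polynomial `L` with
  `L(0) = 1` and `t L' = L S`): `coeff_eq_neg_sum_roots_of_logDeriv` (`[t^r] S = -Σ_{L(z)=0} z^{-r}`),
  `X_mul_derivative_coe_prod`, `roots_prod_of_coeff_zero_eq_one`, and the two transfer lemmas used to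
  turn estimates into the Riemann hypothesis and back:
  `norm_inv_le_of_logDeriv_bound` (if `‖[t^s] Σᵢ Sᵢ‖ ≤ C ρ^s` for all `s ≥ 1` then every root `z` of
  every `Lᵢ` has `‖z‖⁻¹ ≤ ρ` — the power-sum lemma `PowerSum.norm_le_of_norm_sum_pow_le` of the tree's
  Hasse–Weil proof, applied to `∏ Lᵢ`) and `norm_coeff_one_le_of_roots`
  (`‖[t¹] S‖ ≤ deg L · ρ` when all roots satisfy `‖z‖⁻¹ ≤ ρ`).

These are the analytic steps of Weil's bound for character sums (as used in
[KohelShparlinski2000, Props. 1–2, Thm. 1]): with `L = L(χ, t)` of degree `≤ 2g - 2 + N deg P`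
(`FunctionFieldRayClassLSeries`) and `ρ = √q` they give `|Σ_{deg v = 1, v ≠ P} χ(v)| ≤ (2g - 2 + N deg P) √q`
once the bound `‖Σ_{χ in an orbit} S_s(χ)‖ ≤ C q^{s/2}` is known (from the Hasse–Weil theorem for the
corresponding coverings). Everything is proved; no named facts.

## References

* M. Rosen, *Number Theory in Function Fields*, GTM 210, Springer 2002, Ch. 5 (proof of Thm. 5.12)
  and Ch. 9. [RosenFunctionFields2002]
* H. Stichtenoth, *Algebraic Function Fields and Codes*, 2nd ed., GTM 254, Springer 2009,
  Prop. 5.1.8, Cor. 5.1.17, Lemma 5.2.5. [Stichtenoth2009]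
-/

noncomputable section

open scoped Classical

namespace Literature.NumberTheory.DiophantineGeometry.AlgFunctionField

universe u v

variable {K : Type u} {F : Type v} [Field K] [Field F] [Algebra K F]

/-! ### The Euler product in coefficient form: `n a_n(χ) = Σ_{r=1}^{n} S_r(χ) a_{n-r}(χ)` -/

section Euler

variable {P : PlaceOver K F}

variable (P) in
/-- **The place power sums** `S_r(χ) = Σ_{v ≠ P, deg v ∣ r} deg v · χ(v)^{r / deg v}` (`r ≥ 1`;
`S_0(χ) := 0`) of a character `χ` of the divisor group, away from the place `P`: the coefficients of
`t · (log L(χ, t))'` (Rosen Ch. 9 / Ch. 5, proof of Thm. 5.12: the logarithmic derivative of the Euler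
product `L(χ, t) = ∏_{v ≠ P} (1 - χ(v) t^{deg v})⁻¹`). A `finsum` over places; over a finite constant
field only the finitely many places of degree `≤ r` contribute. [cite: RosenFunctionFields2002, Ch. 9] -/
def placePowerSum (χ : AddChar (Divisor K F) ℂ) (r : ℕ) : ℂ :=
  ∑ᶠ v : PlaceOver K F,
    if v ≠ P ∧ v.degree ∣ r ∧ r ≠ 0 then
      (v.degree : ℂ) * χ (Finsupp.single v 1) ^ (r / v.degree) else 0

/-- `S_0(χ) = 0`. [folklore] -/
@[simp]
theorem placePowerSum_zero (χ : AddChar (Divisor K F) ℂ) : placePowerSum P χ 0 = 0 := by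
  simp [placePowerSum]

/-- `S_r(χ)` as a sum over any finite set of places containing those of degree `≤ r` (`r ≥ 1`).
[folklore] -/
theorem placePowerSum_eq_sum (χ : AddChar (Divisor K F) ℂ) {r : ℕ}
    (hr : r ≠ 0) (S : Finset (PlaceOver K F)) (hS : ∀ v : PlaceOver K F, v.degree ≤ r → v ∈ S) :
    placePowerSum P χ r =
      ∑ v ∈ S, if v ≠ P ∧ v.degree ∣ r then
        (v.degree : ℂ) * χ (Finsupp.single v 1) ^ (r / v.degree) else 0 := by
  rw [placePowerSum, finsum_eq_sum_of_support_subset _ (s := S)]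
  · refine Finset.sum_congr rfl fun v _ => ?_
    simp [hr]
  · intro v hv
    rw [Function.mem_support] at hv
    have h : v ≠ P ∧ v.degree ∣ r ∧ r ≠ 0 := by
      by_contra hc
      exact hv (if_neg hc)
    exact hS v (Nat.le_of_dvd (Nat.pos_of_ne_zero hr) h.2.1)

variable [Finite K] [IsAlgFunctionField K F]

omit [Finite K] [IsAlgFunctionField K F] in
/-- Double counting, first step (weighted): summing `deg A · χ(A) = Σ_v A(v) deg v · χ(A)` over the
positive divisors of degree `n` prime to `P`:
`n · a_n(χ) = Σ_{v ≠ P} deg v · Σ_A A(v) χ(A)`, the outer sum over any finite set of places containing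
those of degree `≤ n`. [folklore] -/
theorem natCast_mul_sum_eq_sum_degree_mul_sum (χ : Divisor K F → ℂ) {n : ℕ}
    (E : Finset (Divisor K F)) (hE : ∀ A, A ∈ E ↔ 0 ≤ A ∧ A.degree = n ∧ A P = 0)
    (S : Finset (PlaceOver K F)) (hS : ∀ v : PlaceOver K F, v.degree ≤ n → v ∈ S) :
    (n : ℂ) * ∑ A ∈ E, χ A =
      ∑ v ∈ S, if v ≠ P then (v.degree : ℂ) * ∑ A ∈ E, (A v : ℂ) * χ A else 0 := by
  calc (n : ℂ) * ∑ A ∈ E, χ A = ∑ A ∈ E, (A.degree : ℂ) * χ A := by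
        rw [Finset.mul_sum]
        refine Finset.sum_congr rfl fun A hA => ?_
        rw [((hE A).mp hA).2.1]
        norm_cast
    _ = ∑ A ∈ E, ∑ v ∈ S, (if v ≠ P then ((A v : ℤ) : ℂ) * (v.degree : ℂ) * χ A else 0) := by
        refine Finset.sum_congr rfl fun A hA => ?_
        obtain ⟨h0, hdeg, hAP⟩ := (hE A).mp hA
        have hdegA : (A.degree : ℂ) = ∑ v ∈ S, ((A v : ℤ) : ℂ) * (v.degree : ℂ) := by
          rw [Divisor.degree_apply,
            Finsupp.sum_of_support_subset A (s := S) (fun v hv => hS v ?_) _ fun v _ => by simp]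
          · push_cast; rfl
          · have h := Divisor.degree_le_degree_of_mem_support h0 hv
            rw [hdeg] at h
            exact_mod_cast h
        rw [hdegA, Finset.sum_mul]
        refine Finset.sum_congr rfl fun v _ => ?_
        split_ifs with hv
        · rfl
        · rw [not_not] at hv
          rw [hv, hAP]
          simp
    _ = ∑ v ∈ S, if v ≠ P then (v.degree : ℂ) * ∑ A ∈ E, (A v : ℂ) * χ A else 0 := by
        rw [Finset.sum_comm]
        refine Finset.sum_congr rfl fun v _ => ?_
        split_ifs with hv
        · rw [Finset.mul_sum]
          exact Finset.sum_congr rfl fun A _ => by ring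
        · simp

omit [Finite K] in
/-- Layer-cake with weights: for a positive divisor `A` of degree `n`,
`A(v) · χ(A) = Σ_{m=1}^{n} [m ≤ A(v)] χ(A)`. [folklore] -/
theorem apply_mul_eq_sum_Icc_ite (χ : Divisor K F → ℂ) {n : ℕ} {A : Divisor K F} (hA : 0 ≤ A)
    (hdeg : A.degree = n) (v : PlaceOver K F) :
    (A v : ℂ) * χ A = ∑ m ∈ Finset.Icc 1 n, if (m : ℤ) ≤ A v then χ A else 0 := by
  rw [Finset.sum_ite, Finset.sum_const_zero, add_zero, Finset.sum_const, nsmul_eq_mul]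
  congr 1
  have h := apply_eq_sum_Icc_ite hA hdeg v
  rw [Finset.sum_boole] at h
  exact_mod_cast h

omit [Finite K] [IsAlgFunctionField K F] in
/-- **Geometric series with a character, combinatorially**: for `v ≠ P`, the shift `A ↦ A - m·v` is a
bijection from the positive divisors `A` of degree `n` prime to `P` with `A(v) ≥ m` onto the positive
divisors of degree `n - m deg v` prime to `P`, and `χ(A) = χ(v)^m χ(A - m·v)`; this is the factor
`(1 - χ(v) t^{deg v})⁻¹ = Σ_m χ(v)^m t^{m deg v}` of the Euler product. `E k` is the finite set of
positive divisors of degree `k` prime to `P`. [cite: RosenFunctionFields2002, Ch. 9] -/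
theorem sum_filter_le_apply_eq (χ : AddChar (Divisor K F) ℂ) {n m : ℕ} {v : PlaceOver K F}
    (hv : v ≠ P) (E : ℕ → Finset (Divisor K F))
    (hE : ∀ k A, A ∈ E k ↔ 0 ≤ A ∧ A.degree = k ∧ A P = 0) :
    ∑ A ∈ (E n).filter (fun A => (m : ℤ) ≤ A v), χ A =
      if m * v.degree ≤ n then
        χ (Finsupp.single v 1) ^ m * ∑ B ∈ E (n - m * v.degree), χ B else 0 := by
  split_ifs with h
  · rw [Finset.mul_sum]
    apply Finset.sum_nbij' (fun A => A - Finsupp.single v (m : ℤ))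
      (fun B => B + Finsupp.single v (m : ℤ))
    · intro A hA
      rw [Finset.mem_filter, hE] at hA
      obtain ⟨⟨hA0, hAdeg, hAP⟩, hAm⟩ := hA
      rw [hE]
      refine ⟨fun w => ?_, ?_, ?_⟩
      · simp only [Finsupp.coe_sub, Finsupp.coe_zero, Pi.sub_apply, Pi.zero_apply,
          Finsupp.single_apply]
        split_ifs with hw
        · subst hw; linarith
        · simpa using hA0 w
      · rw [map_sub, hAdeg, Divisor.degree_single, Nat.cast_sub h, Nat.cast_mul]
      · rw [Finsupp.sub_apply, hAP, Finsupp.single_apply, if_neg hv, sub_zero]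
    · intro B hB
      rw [hE] at hB
      obtain ⟨hB0, hBdeg, hBP⟩ := hB
      rw [Finset.mem_filter, hE]
      refine ⟨⟨fun w => ?_, ?_, ?_⟩, ?_⟩
      · simp only [Finsupp.coe_add, Finsupp.coe_zero, Pi.add_apply, Pi.zero_apply,
          Finsupp.single_apply]
        have := hB0 w
        simp only [Finsupp.coe_zero, Pi.zero_apply] at this
        split_ifs <;> positivity
      · rw [map_add, hBdeg, Divisor.degree_single, Nat.cast_sub h, Nat.cast_mul]
        ring
      · rw [Finsupp.add_apply, hBP, Finsupp.single_apply, if_neg hv, add_zero]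
      · have := hB0 v
        simp only [Finsupp.coe_zero, Pi.zero_apply] at this
        simp only [Finsupp.coe_add, Pi.add_apply, Finsupp.single_eq_same]
        linarith
    · intro A _
      simp
    · intro B _
      simp
    · intro A _
      have hsplit : A = (A - Finsupp.single v (m : ℤ)) + m • Finsupp.single v (1 : ℤ) := by
        rw [Finsupp.smul_single, nsmul_one, sub_add_cancel]
      conv_lhs => rw [hsplit]
      rw [AddChar.map_add_eq_mul, AddChar.map_nsmul_eq_pow, mul_comm]
  · apply Finset.sum_eq_zero
    intro A hA
    exfalso
    rw [Finset.mem_filter, hE] at hA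
    obtain ⟨⟨hA0, hAdeg, -⟩, hle⟩ := hA
    have h1 := Divisor.apply_mul_degree_le_degree hA0 v
    rw [hAdeg] at h1
    have h2 : (m : ℤ) * v.degree ≤ A v * v.degree :=
      mul_le_mul_of_nonneg_right hle (Nat.cast_nonneg _)
    have h3 : ((m * v.degree : ℕ) : ℤ) ≤ n := by push_cast; linarith
    exact h (by exact_mod_cast h3)

omit [Finite K] [IsAlgFunctionField K F] in
/-- Reindexing `r = m · d` for `d ≥ 1` (weighted):
`Σ_{m=1}^{n} [m d ≤ n] c^m f(n - m d) = Σ_{r=1}^{n} [d ∣ r] c^{r/d} f(n - r)`. [folklore] -/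
theorem sum_Icc_ite_mul_le_eq_sum_Icc_ite_dvd' (n : ℕ) {d : ℕ} (hd : 1 ≤ d) (c : ℂ) (f : ℕ → ℂ) :
    (∑ m ∈ Finset.Icc 1 n, if m * d ≤ n then c ^ m * f (n - m * d) else 0) =
      ∑ r ∈ Finset.Icc 1 n, if d ∣ r then c ^ (r / d) * f (n - r) else 0 := by
  rw [← Finset.sum_filter, ← Finset.sum_filter]
  have himage : (Finset.Icc 1 n).filter (fun r => d ∣ r) =
      ((Finset.Icc 1 n).filter fun m => m * d ≤ n).image (· * d) := by
    ext r
    simp only [Finset.mem_filter, Finset.mem_Icc, Finset.mem_image]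
    constructor
    · rintro ⟨⟨h1, h2⟩, k, rfl⟩
      refine ⟨k, ⟨⟨?_, ?_⟩, ?_⟩, by ring⟩
      · rcases Nat.eq_zero_or_pos k with hk | hk
        · subst hk; simp at h1
        · exact hk
      · nlinarith
      · nlinarith
    · rintro ⟨m, ⟨⟨h1, h2⟩, h3⟩, rfl⟩
      exact ⟨⟨by nlinarith, h3⟩, dvd_mul_left d m⟩
  rw [himage, Finset.sum_image]
  · refine Finset.sum_congr rfl fun m _ => ?_
    rw [Nat.mul_div_cancel _ (by omega)]
  · intro a _ b _ hab
    exact Nat.eq_of_mul_eq_mul_right (by omega) hab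

/-- **The Euler product of `L(χ, t)`, coefficient form** (Rosen Ch. 9; as for the zeta function,
Ch. 5, proof of Thm. 5.12, and Stichtenoth Prop. 5.1.8): for a character `χ` of the divisor group
and every `n`, `n · a_n(χ) = Σ_{r=1}^{n} S_r(χ) · a_{n-r}(χ)`, where
`a_d(χ) = Σ_{D ≥ 0, deg D = d, P ∉ supp D} χ(D)` and `S_r(χ) = Σ_{v ≠ P, deg v ∣ r} deg v χ(v)^{r/deg v}`.
This is the logarithmic derivative of `L(χ, t) = ∏_{v ≠ P} (1 - χ(v) t^{deg v})⁻¹`, proved by double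
counting (no convergence). [cite: RosenFunctionFields2002, Ch. 9] [cite: Stichtenoth2009, Prop. 5.1.8] -/
theorem natCast_mul_rayClassCoeff_eq_sum (χ : AddChar (Divisor K F) ℂ) (n : ℕ) :
    (n : ℂ) * rayClassCoeff P χ n =
      ∑ r ∈ Finset.Icc 1 n, placePowerSum P χ r * rayClassCoeff P χ (n - r) := by
  -- the finite sets of positive divisors of degree `k` prime to `P`, and of places of degree `≤ n`
  have hfin : ∀ k : ℕ, {A : Divisor K F | 0 ≤ A ∧ A.degree = k ∧ A P = 0}.Finite := fun k =>
    (finite_setOf_nonneg_and_degree_eq (K := K) (F := F) k).subset fun A h => ⟨h.1, h.2.1⟩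
  set E : ℕ → Finset (Divisor K F) := fun k => (hfin k).toFinset with hEdef
  have hE : ∀ k A, A ∈ E k ↔ 0 ≤ A ∧ A.degree = k ∧ A P = 0 := fun k A => by
    simp [hEdef, Set.Finite.mem_toFinset]
  have hS_fin : {v : PlaceOver K F | v.degree ≤ n}.Finite := finite_setOf_degree_le n
  set S : Finset (PlaceOver K F) := hS_fin.toFinset with hSdef
  have hS : ∀ v : PlaceOver K F, v.degree ≤ n → v ∈ S := fun v hv => by
    simpa [hSdef, Set.Finite.mem_toFinset] using hv
  -- the coefficients as sums over `E k`
  have hak : ∀ k, rayClassCoeff P χ k = ∑ A ∈ E k, χ A := by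
    intro k
    letI : Fintype (PosDivPrimeTo P k) := Fintype.ofFinite _
    rw [rayClassCoeff_eq_sum]
    refine Finset.sum_nbij (fun D => D.1) (fun D _ => (hE k D.1).2 D.2) ?_ ?_ (fun _ _ => rfl)
    · intro D _ D' _ h
      exact Subtype.ext h
    · intro A hA
      exact ⟨⟨A, (hE k A).1 (Finset.mem_coe.1 hA)⟩, Finset.mem_coe.2 (Finset.mem_univ _), rfl⟩
  -- the right-hand side as a double sum over places and `r`
  have hR : ∑ r ∈ Finset.Icc 1 n, placePowerSum P χ r * rayClassCoeff P χ (n - r) =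
      ∑ v ∈ S, ∑ r ∈ Finset.Icc 1 n,
        if v ≠ P ∧ v.degree ∣ r then
          (v.degree : ℂ) * χ (Finsupp.single v 1) ^ (r / v.degree) * rayClassCoeff P χ (n - r)
        else 0 := by
    rw [Finset.sum_comm]
    refine Finset.sum_congr rfl fun r hr => ?_
    rw [Finset.mem_Icc] at hr
    rw [placePowerSum_eq_sum χ (by omega) S (fun v hv => hS v (hv.trans hr.2)), Finset.sum_mul]
    exact Finset.sum_congr rfl fun v _ => by split_ifs <;> simp
  rw [hR, hak n, natCast_mul_sum_eq_sum_degree_mul_sum χ (E n) (hE n) S hS]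
  refine Finset.sum_congr rfl fun v _ => ?_
  by_cases hv : v = P
  · simp [hv]
  rw [if_pos hv]
  -- `Σ_A A(v) χ(A) = Σ_m Σ_{A(v) ≥ m} χ(A) = Σ_m [m deg v ≤ n] χ(v)^m a_{n - m deg v}`
  have h1 : ∑ A ∈ E n, (A v : ℂ) * χ A =
      ∑ m ∈ Finset.Icc 1 n, ∑ A ∈ (E n).filter (fun A => (m : ℤ) ≤ A v), χ A := by
    calc ∑ A ∈ E n, (A v : ℂ) * χ A
        = ∑ A ∈ E n, ∑ m ∈ Finset.Icc 1 n, (if (m : ℤ) ≤ A v then χ A else 0) :=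
          Finset.sum_congr rfl fun A hA =>
            apply_mul_eq_sum_Icc_ite χ ((hE n A).mp hA).1 ((hE n A).mp hA).2.1 v
      _ = ∑ m ∈ Finset.Icc 1 n, ∑ A ∈ (E n).filter (fun A => (m : ℤ) ≤ A v), χ A := by
          rw [Finset.sum_comm]
          exact Finset.sum_congr rfl fun m _ => (Finset.sum_filter _ _).symm
  have h2 : ∑ m ∈ Finset.Icc 1 n, ∑ A ∈ (E n).filter (fun A => (m : ℤ) ≤ A v), χ A =
      ∑ m ∈ Finset.Icc 1 n,
        if m * v.degree ≤ n then
          χ (Finsupp.single v 1) ^ m * rayClassCoeff P χ (n - m * v.degree) else 0 := by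
    refine Finset.sum_congr rfl fun m _ => ?_
    rw [sum_filter_le_apply_eq χ hv E hE, hak]
  rw [h1, h2, sum_Icc_ite_mul_le_eq_sum_Icc_ite_dvd' n (PlaceOver.one_le_degree v), Finset.mul_sum]
  refine Finset.sum_congr rfl fun r _ => ?_
  simp only [hv, ne_eq, not_false_eq_true, true_and]
  split_ifs <;> ring

/-- **`t · L'(χ, t) = L(χ, t) · Σ_{r ≥ 1} S_r(χ) t^r` in `ℂ⟦t⟧`** (the Euler product of `L(χ, t)`
through its logarithmic derivative; Rosen Ch. 9): the recursion `natCast_mul_rayClassCoeff_eq_sum`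
packaged as an identity of formal power series. [cite: RosenFunctionFields2002, Ch. 9] -/
theorem X_mul_derivative_rayClassLSeries (χ : AddChar (Divisor K F) ℂ) :
    PowerSeries.X * PowerSeries.derivative ℂ (rayClassLSeries P χ) =
      rayClassLSeries P χ * PowerSeries.mk (placePowerSum P χ) := by
  ext n
  rcases n with _ | n
  · simp [PowerSeries.coeff_mul]
  · rw [PowerSeries.coeff_succ_X_mul, PowerSeries.coeff_derivative, PowerSeries.coeff_mul,
      Finset.Nat.sum_antidiagonal_eq_sum_range_succ
        (fun i j => PowerSeries.coeff i (rayClassLSeries P χ) *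
          PowerSeries.coeff j (PowerSeries.mk (placePowerSum P χ))) (n + 1)]
    simp only [coeff_rayClassLSeries, PowerSeries.coeff_mk, Nat.succ_eq_add_one]
    rw [sum_range_mul_eq_sum_Icc_mul (fun k => rayClassCoeff P χ k) (fun k => placePowerSum P χ k) n
      (placePowerSum_zero χ), mul_comm]
    have h := natCast_mul_rayClassCoeff_eq_sum (P := P) χ (n + 1)
    push_cast at h
    exact h

end Euler

/-! ### From `t L'/L` to the inverse roots: `S_r = -Σ αᵢ^r`, and the transfer of bounds -/

section LogDeriv

open PowerSeries Polynomial

/-- **The coefficients of `t L'/L` are minus the power sums of the inverse roots**: if `L ∈ ℂ[t]` has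
`L(0) = 1` and `t L' = L · S` in `ℂ⟦t⟧`, then `[t^r] S = -Σ_{L(z)=0} z^{-r}` for `r ≥ 1` (the sum over
the complex roots with multiplicity). Indeed `L = ∏ (1 - z⁻¹ t)` (`LPolynomial.eq_prod_one_sub_inv_mul_X`)
and `t (1 - αt)'/(1 - αt) = -Σ_{r ≥ 1} α^r t^r` (Stichtenoth, proof of Cor. 5.1.17 (a)).
[cite: Stichtenoth2009, Cor. 5.1.17(a)] -/
theorem coeff_eq_neg_sum_roots_of_logDeriv {L : ℂ[X]} (h0 : L.coeff 0 = 1) {S : ℂ⟦X⟧}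
    (hE : PowerSeries.X * d⁄dX ℂ (L : ℂ⟦X⟧) = (L : ℂ⟦X⟧) * S) {r : ℕ} (hr : 0 < r) :
    PowerSeries.coeff r S = -(L.roots.map fun z => z⁻¹ ^ r).sum := by
  -- the geometric series, kept opaque
  obtain ⟨geom, hgeom⟩ : ∃ g : ℂ → ℂ⟦X⟧,
      g = fun a => PowerSeries.mk fun r => if r = 0 then 0 else a ^ r := ⟨_, rfl⟩
  have hgeomD : ∀ a : ℂ, PowerSeries.X * d⁄dX ℂ (1 - PowerSeries.C a * PowerSeries.X) =
      (1 - PowerSeries.C a * PowerSeries.X) * -geom a := by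
    intro a; rw [hgeom]; exact LPolynomial.X_mul_derivative_one_sub_C_mul_X a
  have hgeomc : ∀ a : ℂ, PowerSeries.coeff r (geom a) = a ^ r := by
    intro a; rw [hgeom, PowerSeries.coeff_mk, if_neg hr.ne']
  -- `L = ∏ (1 - z⁻¹ X)` over the roots
  have hroots : Multiset.card L.roots = L.natDegree := IsAlgClosed.card_roots_eq_natDegree
  have hprod := LPolynomial.eq_prod_one_sub_inv_mul_X L hroots h0
  have hcoe : (L : ℂ⟦X⟧) = (L.roots.map fun z => (1 - PowerSeries.C z⁻¹ * PowerSeries.X : ℂ⟦X⟧)).prod := by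
    conv_lhs => rw [hprod]
    have h := map_multiset_prod (Polynomial.coeToPowerSeries.ringHom (R := ℂ))
      (L.roots.map fun z => 1 - Polynomial.C z⁻¹ * Polynomial.X)
    rw [Polynomial.coeToPowerSeries.ringHom_apply, Multiset.map_map] at h
    rw [h]
    refine congrArg _ (Multiset.map_congr rfl fun z _ => ?_)
    simp [Polynomial.coeToPowerSeries.ringHom_apply]
  -- logarithmic derivative of the product
  have hD : PowerSeries.X * d⁄dX ℂ (L : ℂ⟦X⟧) = (L : ℂ⟦X⟧) * (L.roots.map fun z => -geom z⁻¹).sum := by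
    rw [hcoe]
    exact LPolynomial.X_mul_derivative_multiset_prod L.roots
      (fun z => (1 - PowerSeries.C z⁻¹ * PowerSeries.X : ℂ⟦X⟧)) (fun z => -geom z⁻¹)
      (fun z _ => hgeomD z⁻¹)
  -- cancel `L ≠ 0`
  have hL0 : (L : ℂ⟦X⟧) ≠ 0 := by
    intro h
    have := congrArg (PowerSeries.coeff 0) h
    rw [Polynomial.coeff_coe, h0, map_zero] at this
    exact one_ne_zero this
  rw [hE] at hD
  have hS : S = (L.roots.map fun z => -geom z⁻¹).sum := mul_left_cancel₀ hL0 hD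
  rw [hS, map_multiset_sum, Multiset.map_map, ← Multiset.sum_map_neg]
  refine congrArg Multiset.sum (Multiset.map_congr rfl fun z _ => ?_)
  simp only [Function.comp_apply, map_neg, hgeomc]

/-- The roots of a product of polynomials with constant coefficient `1`: such polynomials are nonzero,
so the roots of the product are the union of the roots. [folklore] -/
theorem roots_prod_of_coeff_zero_eq_one {ι : Type*} (s : Finset ι) (L : ι → ℂ[X])
    (h0 : ∀ i ∈ s, (L i).coeff 0 = 1) :
    (∏ i ∈ s, L i).roots = s.val.bind fun i => (L i).roots := by
  apply Polynomial.roots_prod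
  rw [Finset.prod_ne_zero_iff]
  intro i hi h
  have := congrArg (Polynomial.coeff · 0) h
  simp only [h0 i hi, Polynomial.coeff_zero] at this
  exact one_ne_zero this

/-- The constant coefficient of a product of polynomials with constant coefficient `1` is `1`.
[folklore] -/
theorem coeff_zero_prod_eq_one {ι : Type*} (s : Finset ι) (L : ι → ℂ[X])
    (h0 : ∀ i ∈ s, (L i).coeff 0 = 1) : (∏ i ∈ s, L i).coeff 0 = 1 := by
  rw [Polynomial.coeff_zero_eq_eval_zero, Polynomial.eval_prod]
  exact Finset.prod_eq_one fun i hi => by rw [← Polynomial.coeff_zero_eq_eval_zero, h0 i hi]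

/-- Logarithmic derivative of a finite product of polynomials: if `t Lᵢ' = Lᵢ Sᵢ` for all `i ∈ s` then
`t (∏ Lᵢ)' = (∏ Lᵢ) · Σ Sᵢ` in `ℂ⟦t⟧`. [folklore] -/
theorem X_mul_derivative_coe_prod {ι : Type*} (s : Finset ι) (L : ι → ℂ[X]) (S : ι → ℂ⟦X⟧)
    (h : ∀ i ∈ s, PowerSeries.X * d⁄dX ℂ (L i : ℂ⟦X⟧) = (L i : ℂ⟦X⟧) * S i) :
    PowerSeries.X * d⁄dX ℂ ((∏ i ∈ s, L i : ℂ[X]) : ℂ⟦X⟧) =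
      ((∏ i ∈ s, L i : ℂ[X]) : ℂ⟦X⟧) * ∑ i ∈ s, S i := by
  have hcoe : ((∏ i ∈ s, L i : ℂ[X]) : ℂ⟦X⟧) = (s.val.map fun i => (L i : ℂ⟦X⟧)).prod := by
    have h := map_prod (Polynomial.coeToPowerSeries.ringHom (R := ℂ)) L s
    rw [Polynomial.coeToPowerSeries.ringHom_apply] at h
    rw [h]
    rfl
  rw [hcoe, Finset.sum_eq_multiset_sum]
  exact LPolynomial.X_mul_derivative_multiset_prod s.val (fun i => (L i : ℂ⟦X⟧)) S
    (fun i hi => h i hi)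

/-- **Transfer of bounds through the logarithmic derivative** (the mechanism of Stichtenoth
Lemma 5.2.5 / of Weil's bound for character sums): let `L₁, …, L_k ∈ ℂ[t]` have constant coefficient
`1` and satisfy `t Lᵢ' = Lᵢ Sᵢ`, and suppose the *total* coefficients are bounded,
`‖[t^s] Σᵢ Sᵢ‖ ≤ C ρ^s` for all `s ≥ 1` (`ρ > 0`). Then every complex root `z` of every `Lᵢ` has
`‖z‖⁻¹ ≤ ρ`. Proof: `[t^s] Σ Sᵢ = -Σ α^s` over the inverse roots `α` of `∏ Lᵢ`
(`coeff_eq_neg_sum_roots_of_logDeriv`), and the power-sum lemma `PowerSum.norm_le_of_norm_sum_pow_le`.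
[cite: Stichtenoth2009, Lemma 5.2.5] -/
theorem norm_inv_le_of_logDeriv_bound {ι : Type*} (s : Finset ι) (L : ι → ℂ[X]) (S : ι → ℂ⟦X⟧)
    (h0 : ∀ i ∈ s, (L i).coeff 0 = 1)
    (hE : ∀ i ∈ s, PowerSeries.X * d⁄dX ℂ (L i : ℂ⟦X⟧) = (L i : ℂ⟦X⟧) * S i)
    {ρ : ℝ} (hρ : 0 < ρ) (C : ℝ)
    (hb : ∀ r : ℕ, 0 < r → ‖PowerSeries.coeff r (∑ i ∈ s, S i)‖ ≤ C * ρ ^ r)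
    {i : ι} (hi : i ∈ s) {z : ℂ} (hz : z ∈ (L i).roots) : ‖z‖⁻¹ ≤ ρ := by
  set Λ : ℂ[X] := ∏ i ∈ s, L i with hΛ
  have hΛ0 : Λ.coeff 0 = 1 := coeff_zero_prod_eq_one s L h0
  have hΛE := X_mul_derivative_coe_prod s L S hE
  -- enumerate the roots of `Λ`
  obtain ⟨e, he⟩ := LPolynomial.exists_fin_enum Λ.roots rfl
  have hzΛ : z ∈ Λ.roots := by
    rw [hΛ, roots_prod_of_coeff_zero_eq_one s L h0, Multiset.mem_bind]
    exact ⟨i, hi, hz⟩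
  obtain ⟨j, rfl⟩ : ∃ j, e j = z := by
    rw [← he, Multiset.mem_map] at hzΛ
    obtain ⟨j, -, hj⟩ := hzΛ
    exact ⟨j, hj⟩
  -- power sums of the inverse roots
  have hps : ∀ r : ℕ, 0 < r → ‖∑ j, (e j)⁻¹ ^ r‖ ≤ C * ρ ^ r := by
    intro r hr
    have h := coeff_eq_neg_sum_roots_of_logDeriv hΛ0 hΛE hr
    have hsum : ∑ j, (e j)⁻¹ ^ r = (Λ.roots.map fun z => z⁻¹ ^ r).sum := by
      have h' : (Λ.roots.map fun z => z⁻¹ ^ r) = (Finset.univ.val.map e).map fun z => z⁻¹ ^ r := by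
        rw [he]
      rw [h', Multiset.map_map, Finset.sum_eq_multiset_sum]
      rfl
    rw [hsum, ← norm_neg, ← h]
    exact hb r hr
  have := PowerSum.norm_le_of_norm_sum_pow_le (fun j => (e j)⁻¹) hρ C hps j
  rwa [norm_inv] at this

/-- **The first coefficient is bounded by the degree times the root bound**: if `L ∈ ℂ[t]` has
`L(0) = 1`, `t L' = L S`, and all roots `z` of `L` satisfy `‖z‖⁻¹ ≤ ρ`, then
`‖[t¹] S‖ ≤ deg L · ρ` (`[t¹] S = -Σ z⁻¹` over the `deg L` roots). This is how
`|Σ_{deg v = 1} χ(v)| ≤ deg L(χ, t) · √q` follows from the Riemann hypothesis for `L(χ, t)`.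
[cite: Stichtenoth2009, Cor. 5.1.17(a)] -/
theorem norm_coeff_one_le_of_roots {L : ℂ[X]} (h0 : L.coeff 0 = 1) {S : ℂ⟦X⟧}
    (hE : PowerSeries.X * d⁄dX ℂ (L : ℂ⟦X⟧) = (L : ℂ⟦X⟧) * S) {ρ : ℝ}
    (hroots : ∀ z ∈ L.roots, ‖z‖⁻¹ ≤ ρ) :
    ‖PowerSeries.coeff 1 S‖ ≤ L.natDegree * ρ := by
  rw [coeff_eq_neg_sum_roots_of_logDeriv h0 hE one_pos, norm_neg]
  have hcard : Multiset.card L.roots = L.natDegree := IsAlgClosed.card_roots_eq_natDegree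
  calc ‖(L.roots.map fun z => z⁻¹ ^ 1).sum‖
      ≤ (L.roots.map fun z => ‖z⁻¹ ^ 1‖).sum := by
        have h := norm_multiset_sum_le (L.roots.map fun z => z⁻¹ ^ 1)
        rwa [Multiset.map_map] at h
    _ ≤ (L.roots.map fun _ => ρ).sum := by
        refine Multiset.sum_map_le_sum_map _ _ fun z hz => ?_
        rw [pow_one, norm_inv]
        exact hroots z hz
    _ = L.natDegree * ρ := by
        rw [Multiset.map_const', Multiset.sum_replicate, hcard, nsmul_eq_mul]

end LogDeriv

end Literature.NumberTheory.DiophantineGeometry.AlgFunctionField
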